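import Summits.BirchSwinnertonDyer.Rank1Residual.X12.InertBadOddPrime
import Summits.BirchSwinnertonDyer.Rank1Residual.X12.InertCoreStepL
import HarnessLib

/-!
# X12 at every ODD bad prime unramified in the CM field (`p = 3` included): the residue IS
# "STEP L" at a Heegner datum with ODD discriminant, and `BSD(E,p)` is EQUIVALENT to it
# (cell `b2b-bsdres`, unit `b2b-bsdres-x1b`, gen 12)

HONEST FRAMING (cell `b2b-bsdres`, run/shared/lean/b2b/bsd-rank1-residual/, verbatim in every
file): the goal of the cell is to DELETE the COMBINATION-SHAPED residual classes of the
Birch–Swinnerton-Dyer formula for ALL analytic-rank `≤ 1` elliptic curves over `ℚ` — "full BSD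
formula for every rank `≤ 1` curve in class `C`" assembled STRICTLY from published theorems — so
that the rank-`≤ 1` remainder becomes exactly the CONSTRUCTION-SHAPED classes, which are TYPED
(missing-input `Prop`s), NOT attempted. This is not "finishing BSD". Unit `b2b-bsdres-x1b`
(CLASS-OWNERS row "X12 inert-bad core", prover owner), generation 12; research route, no claim
beyond the stated class; X12 REMAINS CONSTRUCTION-SHAPED; nothing is booked.
Theorems only; no definition, no new named fact; CONDITIONAL statements (STEP L is OPEN at an
additive prime) and equivalences.

Gen 10 (`X12/InertCoreStepL.lean`, p216946) proved, on ClassX12 ∧ `p ≥ 5` ∧ `p ∤ d_K`, modulo the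
Manin datum: `BSD(E,p) ⟺ STEP L` (`X11b.IndexLowerBoundAt W p K P`:
`2·ord_p [E(K):ℤP] ≤ ord_p #Ш(E/K) + 2·ord_p ∏c_ℓ(E)`, JSW 2017 (eq:shalowerK-1) = Castella 2018
(1.1)) at every Heegner datum over an imaginary quadratic `K` with the Heegner hypothesis,
`|d_K| > 4`, `L(E^{(d_K)},1) ≠ 0. Gen 12 (`X12/InertBadOddPrime.lean`, p221628) moved the UPPER
half to every ODD such `p` — the `p = 3` inert-bad sub-family (CM by `K ≠ ℚ(√−3)`, `3 ∣ N`) — using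
eisenstein-p2's Tamagawa transport at odd `p ∤ d_K` with `d_K` ODD
(`X2.padicValNat_tamagawaProduct_twist_of_heegner_of_odd`: type `I₀*` at `ℓ ∣ d_K`, `ℓ ≥ 5`). This
file does the same for the STEP-L equivalence: at `p = 3` the Heegner data are restricted to fields
with ODD discriminant (`2` split in `K` when `2 ∤ N`; automatic when `2 ∣ N`), which the
Friedberg–Hoffstein fact supplies (its free prescribed-split prime spent on `2`), and the Tamagawa
datum `p ∤ ∏c_ℓ(E)` is a binder (automatic for `p ≥ 5`).

* `missingLowerBoundAt_of_hasCM_rankOne_of_indexLowerBoundAt_odd` — STEP L at ONE Heegner datum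
  with `d_K` odd ⟹ `MissingLowerBoundAt W p` (CM, `r_an = 1`, `p ≠ 2`, `p ∣ N`, `p ∤ d_K`; Manin
  datum; the twist's half DISCHARGED by Rubin / Burungale–Flach, gen 10's
  `exists_printShape_eq_twist_of_hasCM`).
* `indexLowerBoundAt_of_hasCM_rankOne_of_missingLowerBoundAt_odd` — RIGIDITY: the lower half ⟹
  STEP L at EVERY such datum.
* `bsdp_of_classX12_of_bad_odd_of_indexLowerBoundAt` / `indexLowerBoundAt_of_classX12_of_bad_odd_of_bsdp`;
  **`bsdp_iff_forall_indexLowerBoundAt_of_classX12_of_bad_odd`**: on ClassX12 ∧ `p ≠ 2` ∧ `p ∣ N` ∧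
  `p ∤ d_K`, modulo the Manin datum and `p ∤ ∏c_ℓ`, `BSD(E,p) ⟺` STEP L at every Heegner datum of
  `D` with `|d_K| > 4`, `d_K` odd, `L(E^{(d_K)},1) ≠ 0`; `missingLowerBoundAt_iff_…` likewise; and
  the `p = 3` sentence `bsdp_three_iff_forall_indexLowerBoundAt_of_classX12_of_bad`.

READING (no label change; nothing booked; X12 CONSTRUCTION-SHAPED): the `p = 3` inert-bad
sub-family of X12 has EXACTLY the residue of the `p ≥ 5` core and of class X11b — STEP L
(equivalently Kolyvagin's conjecture `m_∞ = 0` at a Friedberg–Hoffstein datum, memo X12-ROUTE §11),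
at an additive potentially supersingular prime; no source proves it there.

References: [JetchevSkinnerWan2017] §7.4.1–7.4.2; [MatarNekovar2019] Thm. 0.3, §0.11;
[BurungaleFlach2024] Thm. 1.1 / Cor. 2; [Rubin1991MainConj] Thm. 11.1; [Darmon2004] Thm. 3.6;
[SilvermanATAEC1994] IV.9.4 Step 6 / Table 4.1; [Miller2011LMS] Def. 1.1.
-/

noncomputable section

open scoped Classical NumberField

open WeierstrassCurve NumberField Literature.NumberTheory.EllipticCurves
  Literature.NumberTheory.EllipticCurves.ModularForms
  Literature.NumberTheory.EllipticCurves.Rank1Residual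
  Literature.NumberTheory.EllipticCurves.Rank1Residual.Typed
  Literature.NumberTheory.Automorphic
  IsDedekindDomain

namespace Summit.BirchSwinnertonDyer.Rank1Residual.X12

/-! ### §1 Data level at a Heegner field with odd discriminant, any odd bad `p ∤ d_K` -/

/-- **STEP L at one Heegner datum with `d_K` ODD ⇒ the LOWER half of `BSD(E,p)`, CM, analytic rank
one, ANY odd bad prime `p` unramified in the CM field — from PUBLISHED facts.** Data as in gen 10's
`missingLowerBoundAt_of_hasCM_rankOne_of_indexLowerBoundAt` with `5 ≤ p` replaced by `p ≠ 2` and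
the extra hypothesis `Odd d_K` (the Tamagawa transport at `p = 3` needs the primes `ℓ ∣ d_K` to be
`≥ 5`: `d_K` odd and `3 ∣ N` split; eisenstein-p2's `X2.padicValNat_tamagawaProduct_twist_of_heegner_of_odd`).
CONDITIONAL on STEP L (OPEN at an additive prime); nothing booked.
[cite: JetchevSkinnerWan2017, §7.4.1 (eq:shalowerK-1)–(eq:shalower), pp. 30–31]
[cite: BurungaleFlach2024, Thm. 1.1 and Cor. 2] [cite: SilvermanATAEC1994, IV.9.4 Step 6 and Table 4.1]
[cite: Miller2011LMS, Def. 1.1] -/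
theorem missingLowerBoundAt_of_hasCM_rankOne_of_indexLowerBoundAt_odd
    (hGZK : rank_eq_analyticRank_of_analyticRank_le_one) (hmod : hasEntireLFunction_rat)
    (hCM8 : bsdTriple_of_hasCM_of_L_one_ne_zero)
    (W : WeierstrassCurve ℚ) [W.IsElliptic] [W.IsGloballyMinimal] (p : ℕ) [Fact p.Prime]
    [NeZero (W.conductorNorm ℤ)] (K : Type) [Field K] [NumberField K]
    (Dt : ModularParametrizationData W (W.conductorNorm ℤ))
    (H : HeegnerDatum (W.conductorNorm ℤ) (NumberField.discr K)) (ι : K →+* ℂ)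
    (P : (W.baseChange K).toAffine.Point)
    (hGZ : gross_zagier (W.conductorNorm ℤ) W K) (hKo : kolyvagin (W.conductorNorm ℤ) W K)
    (hCM : W.HasCM) (hr : W.analyticRank = 1) (hp2 : p ≠ 2) (hbad : ¬ Good W p)
    (hnr : ¬ CMRamified W p)
    (hK : IsImaginaryQuadratic K) (hodd : Odd (NumberField.discr K))
    (hHN : SatisfiesHeegnerHypothesis (W.conductorNorm ℤ) K)
    (hP : WeierstrassCurve.Affine.Point.map ι.toRatAlgHom P = heegnerPointComplex Dt H)
    (hc : ¬ (p : ℤ) ∣ Dt.c) (hμ : ¬ p ∣ Units.torsionOrder K)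
    (hLt : (W.quadraticTwist (NumberField.discr K : ℚ)).entireLFunction 1 ≠ 0)
    (hL : Finite (W.baseChange K).sha → X11b.IndexLowerBoundAt W p K P) :
    MissingLowerBoundAt W p := by
  have hp : p.Prime := Fact.out
  have hpN : p ∣ W.conductorNorm ℤ := (W.dvd_conductorNorm_iff_not_hasGoodReductionAtPrime p).mpr hbad
  have hpd : ¬ (p : ℤ) ∣ NumberField.discr K :=
    Literature.SatisfiesHeegnerHypothesis.not_dvd_discr hK.1 hHN hp hpN
  have hirr : Irr W p := irr_of_not_cmRamified W p hp2 hnr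
  have hD0 : (NumberField.discr K : ℚ) ≠ 0 := by exact_mod_cast NumberField.discr_ne_zero K
  haveI hEt : (W.quadraticTwist (NumberField.discr K : ℚ)).IsElliptic :=
    W.isElliptic_quadraticTwist hD0
  obtain ⟨Cd, hCd⟩ := hasGlobalMinimalModel_rat_holds (W.quadraticTwist (NumberField.discr K : ℚ))
  haveI : (Cd • W.quadraticTwist (NumberField.discr K : ℚ)).IsGloballyMinimal := hCd
  have hWd : Cd • W.quadraticTwist (NumberField.discr K : ℚ) =
      Cd • W.quadraticTwist (NumberField.discr K : ℚ) := rfl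
  -- transports to the minimal twist model (Tamagawa: odd `p ∤ d_K`, `d_K` odd — type `I₀*`)
  have hirrd : Irr (Cd • W.quadraticTwist (NumberField.discr K : ℚ)) p :=
    X11b.hasIrreducibleModPGaloisRep_twist_model W p K hK.1 hirr Cd hWd
  have htam : padicValNat p (Cd • W.quadraticTwist (NumberField.discr K : ℚ)).tamagawaProduct =
      padicValNat p W.tamagawaProduct :=
    X2.padicValNat_tamagawaProduct_twist_of_heegner_of_odd W p hp2 K hK hodd hpd hHN Cd hWd
  have hu : padicValRat p (Cd.u : ℚ) = 0 :=
    AdditivePotMult.padicValRat_u_eq_zero_of_twist_minimal_of_dvd W p K hK hHN hpN Cd hWd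
  -- the twist has analytic rank `0`; being CM, its `p`-part in print shape is an equality
  have hrd : (Cd • W.quadraticTwist (NumberField.discr K : ℚ)).analyticRank = 0 := by
    rw [analyticRank_smul]
    exact analyticRank_eq_zero_of_entireLFunction_one_ne_zero _ hLt
  obtain ⟨qd, hqd, hvqd⟩ := exists_printShape_eq_twist_of_hasCM hCM8 hmod hGZK W hCM p hD0
    (Cd • W.quadraticTwist (NumberField.discr K : ℚ)) ⟨Cd, rfl⟩ hrd hirrd
  exact X11b.missingLowerBoundAt_of_indexLowerBoundAt W p (W.conductorNorm ℤ) K Dt H ι P hGZ hKo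
    hGZK hmod hK hHN hP hp2 hc hμ hr hLt (Cd • W.quadraticTwist (NumberField.discr K : ℚ)) Cd hWd hu
    htam ⟨qd, hqd, hvqd.symm.le⟩ hL

/-- **RIGIDITY at any odd bad `p ∤ d_K`: the LOWER half of `BSD(E,p)` ⇒ STEP L at EVERY Heegner
datum with `d_K` odd** (same data and binders, `hlow : MissingLowerBoundAt W p` in place of `hL`),
via multr1-p2's `X11b.indexLowerBoundAt_of_missingLowerBoundAt`. Bookkeeping on published facts.
[cite: JetchevSkinnerWan2017, §7.4.1 (eq:gz for K′), (eq:tamK), pp. 29–30] [cite: Miller2011LMS, Def. 1.1] -/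
theorem indexLowerBoundAt_of_hasCM_rankOne_of_missingLowerBoundAt_odd
    (hGZK : rank_eq_analyticRank_of_analyticRank_le_one) (hmod : hasEntireLFunction_rat)
    (hCM8 : bsdTriple_of_hasCM_of_L_one_ne_zero)
    (W : WeierstrassCurve ℚ) [W.IsElliptic] [W.IsGloballyMinimal] (p : ℕ) [Fact p.Prime]
    [NeZero (W.conductorNorm ℤ)] (K : Type) [Field K] [NumberField K]
    (Dt : ModularParametrizationData W (W.conductorNorm ℤ))
    (H : HeegnerDatum (W.conductorNorm ℤ) (NumberField.discr K)) (ι : K →+* ℂ)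
    (P : (W.baseChange K).toAffine.Point)
    (hGZ : gross_zagier (W.conductorNorm ℤ) W K) (hKo : kolyvagin (W.conductorNorm ℤ) W K)
    (hCM : W.HasCM) (hr : W.analyticRank = 1) (hp2 : p ≠ 2) (hbad : ¬ Good W p)
    (hnr : ¬ CMRamified W p)
    (hK : IsImaginaryQuadratic K) (hodd : Odd (NumberField.discr K))
    (hHN : SatisfiesHeegnerHypothesis (W.conductorNorm ℤ) K)
    (hP : WeierstrassCurve.Affine.Point.map ι.toRatAlgHom P = heegnerPointComplex Dt H)
    (hc : ¬ (p : ℤ) ∣ Dt.c) (hμ : ¬ p ∣ Units.torsionOrder K)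
    (hLt : (W.quadraticTwist (NumberField.discr K : ℚ)).entireLFunction 1 ≠ 0)
    (hlow : MissingLowerBoundAt W p) :
    X11b.IndexLowerBoundAt W p K P := by
  have hp : p.Prime := Fact.out
  have hpN : p ∣ W.conductorNorm ℤ := (W.dvd_conductorNorm_iff_not_hasGoodReductionAtPrime p).mpr hbad
  have hpd : ¬ (p : ℤ) ∣ NumberField.discr K :=
    Literature.SatisfiesHeegnerHypothesis.not_dvd_discr hK.1 hHN hp hpN
  have hirr : Irr W p := irr_of_not_cmRamified W p hp2 hnr
  have hD0 : (NumberField.discr K : ℚ) ≠ 0 := by exact_mod_cast NumberField.discr_ne_zero K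
  haveI hEt : (W.quadraticTwist (NumberField.discr K : ℚ)).IsElliptic :=
    W.isElliptic_quadraticTwist hD0
  obtain ⟨Cd, hCd⟩ := hasGlobalMinimalModel_rat_holds (W.quadraticTwist (NumberField.discr K : ℚ))
  haveI : (Cd • W.quadraticTwist (NumberField.discr K : ℚ)).IsGloballyMinimal := hCd
  have hWd : Cd • W.quadraticTwist (NumberField.discr K : ℚ) =
      Cd • W.quadraticTwist (NumberField.discr K : ℚ) := rfl
  have hirrd : Irr (Cd • W.quadraticTwist (NumberField.discr K : ℚ)) p :=
    X11b.hasIrreducibleModPGaloisRep_twist_model W p K hK.1 hirr Cd hWd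
  have htam : padicValNat p (Cd • W.quadraticTwist (NumberField.discr K : ℚ)).tamagawaProduct =
      padicValNat p W.tamagawaProduct :=
    X2.padicValNat_tamagawaProduct_twist_of_heegner_of_odd W p hp2 K hK hodd hpd hHN Cd hWd
  have hu : padicValRat p (Cd.u : ℚ) = 0 :=
    AdditivePotMult.padicValRat_u_eq_zero_of_twist_minimal_of_dvd W p K hK hHN hpN Cd hWd
  have hrd : (Cd • W.quadraticTwist (NumberField.discr K : ℚ)).analyticRank = 0 := by
    rw [analyticRank_smul]
    exact analyticRank_eq_zero_of_entireLFunction_one_ne_zero _ hLt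
  obtain ⟨qd, hqd, hvqd⟩ := exists_printShape_eq_twist_of_hasCM hCM8 hmod hGZK W hCM p hD0
    (Cd • W.quadraticTwist (NumberField.discr K : ℚ)) ⟨Cd, rfl⟩ hrd hirrd
  exact X11b.indexLowerBoundAt_of_missingLowerBoundAt W p (W.conductorNorm ℤ) K Dt H ι P hGZ hKo
    hGZK hmod hK hHN hP hp2 hc hμ hr hLt (Cd • W.quadraticTwist (NumberField.discr K : ℚ)) Cd hWd hu
    htam ⟨qd, hqd, hvqd.le⟩ hlow

/-! ### §2 Class level: `BSD(E,p)` ⟺ STEP L, any odd bad `p ∤ d_K` (`p = 3` included) -/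

/-! The PUBLISHED named facts used at class level (as in gen 9 / gen 12). -/
variable
  (hGZ : ∀ (N : ℕ) [NeZero N] (W : WeierstrassCurve ℚ) (K : Type) [Field K] [NumberField K],
    gross_zagier N W K)
  (hKo : ∀ (N : ℕ) [NeZero N] (W : WeierstrassCurve ℚ) (K : Type) [Field K] [NumberField K],
    kolyvagin N W K)
  (hMN : ∀ (N : ℕ) [NeZero N] (W : WeierstrassCurve ℚ) (K : Type) [Field K] [NumberField K],
    MatarNekovar2019.thm03_padicValNat_card_sha_le_of_irreducible N W K)
  (hGZK : rank_eq_analyticRank_of_analyticRank_le_one) (hmod : hasEntireLFunction_rat)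
  (hnf : exists_isNewformOf) (hFH : friedbergHoffstein_exists_heegnerField_split_twist_ne_zero)
  (hCM8 : bsdTriple_of_hasCM_of_L_one_ne_zero)

include hGZ hKo hMN hGZK hmod hnf hFH hCM8

/-- **`BSD(E,p)` on X12 ∧ `p ≠ 2` ∧ `p ∣ N` ∧ `p ∤ d_K` from STEP L at ONE Heegner datum with `d_K`
odd**, modulo the Manin datum `p ∤ c(Dt)` and `p ∤ ∏c_ℓ(E)`: lower half by
`missingLowerBoundAt_of_hasCM_rankOne_of_indexLowerBoundAt_odd`, upper half = gen 12
(`bsdp_of_classX12_of_bad_odd_of_lower`). CONDITIONAL on STEP L; nothing booked.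
[cite: JetchevSkinnerWan2017, §7.4.1–7.4.2 (pp. 30–31)] [cite: MatarNekovar2019, Thm. 0.3 and §0.11]
[cite: Miller2011LMS, §1 and Def. 1.1] -/
theorem bsdp_of_classX12_of_bad_odd_of_indexLowerBoundAt
    (W : WeierstrassCurve ℚ) [W.IsElliptic] [W.IsGloballyMinimal] (p : ℕ) [Fact p.Prime]
    [NeZero (W.conductorNorm ℤ)] (K : Type) [Field K] [NumberField K]
    (Dt : ModularParametrizationData W (W.conductorNorm ℤ))
    (H : HeegnerDatum (W.conductorNorm ℤ) (NumberField.discr K)) (ι : K →+* ℂ)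
    (P : (W.baseChange K).toAffine.Point)
    (hX : ClassX12 W p) (hp2 : p ≠ 2) (hbad : ¬ Good W p) (hnr : ¬ CMRamified W p)
    (hK : IsImaginaryQuadratic K) (hodd : Odd (NumberField.discr K))
    (hHN : SatisfiesHeegnerHypothesis (W.conductorNorm ℤ) K)
    (hP : WeierstrassCurve.Affine.Point.map ι.toRatAlgHom P = heegnerPointComplex Dt H)
    (hc : ¬ (p : ℤ) ∣ Dt.c) (hμ : ¬ p ∣ Units.torsionOrder K)
    (hLt : (W.quadraticTwist (NumberField.discr K : ℚ)).entireLFunction 1 ≠ 0)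
    (htam : ¬ p ∣ W.tamagawaProduct)
    (hL : Finite (W.baseChange K).sha → X11b.IndexLowerBoundAt W p K P) : BSDp W p :=
  bsdp_of_classX12_of_bad_odd_of_lower hGZ hKo hMN hGZK hmod hnf hFH hCM8 W p hX hp2 hbad hnr Dt hc
    htam
    (missingLowerBoundAt_of_hasCM_rankOne_of_indexLowerBoundAt_odd hGZK hmod hCM8 W p K Dt H ι P
      (hGZ _ W K) (hKo _ W K) hX.1 hX.2.1 hp2 hbad hnr hK hodd hHN hP hc hμ hLt hL)

omit hMN hnf hFH in
/-- **Conversely, `BSD(E,p)` on X12 ∧ `p ≠ 2` ∧ `p ∣ N` ∧ `p ∤ d_K` ⇒ STEP L at EVERY Heegner datum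
with `d_K` odd** (rigidity; `Ш(E)` finite by GZK in analytic rank one).
[cite: JetchevSkinnerWan2017, §7.4.1 (eq:gz for K′), pp. 29–30] [cite: Miller2011LMS, §1 and Def. 1.1] -/
theorem indexLowerBoundAt_of_classX12_of_bad_odd_of_bsdp
    (W : WeierstrassCurve ℚ) [W.IsElliptic] [W.IsGloballyMinimal] (p : ℕ) [Fact p.Prime]
    [NeZero (W.conductorNorm ℤ)] (K : Type) [Field K] [NumberField K]
    (Dt : ModularParametrizationData W (W.conductorNorm ℤ))
    (H : HeegnerDatum (W.conductorNorm ℤ) (NumberField.discr K)) (ι : K →+* ℂ)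
    (P : (W.baseChange K).toAffine.Point)
    (hX : ClassX12 W p) (hp2 : p ≠ 2) (hbad : ¬ Good W p) (hnr : ¬ CMRamified W p)
    (hK : IsImaginaryQuadratic K) (hodd : Odd (NumberField.discr K))
    (hHN : SatisfiesHeegnerHypothesis (W.conductorNorm ℤ) K)
    (hP : WeierstrassCurve.Affine.Point.map ι.toRatAlgHom P = heegnerPointComplex Dt H)
    (hc : ¬ (p : ℤ) ∣ Dt.c) (hμ : ¬ p ∣ Units.torsionOrder K)
    (hLt : (W.quadraticTwist (NumberField.discr K : ℚ)).entireLFunction 1 ≠ 0)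
    (hb : BSDp W p) : X11b.IndexLowerBoundAt W p K P := by
  haveI : Finite W.sha := (hGZK W (by rw [hX.2.1])).2
  exact indexLowerBoundAt_of_hasCM_rankOne_of_missingLowerBoundAt_odd hGZK hmod hCM8 W p K Dt H ι P
    (hGZ _ W K) (hKo _ W K) hX.1 hX.2.1 hp2 hbad hnr hK hodd hHN hP hc hμ hLt
    (lower_and_upper_of_missingPPartAt W p (missingPPartAt_of_bsdp W p hb)).1

/-- **The class sentence at every odd bad `p ∤ d_K`, `p = 3` included: on ClassX12 ∧ `p ≠ 2` ∧
`p ∣ N` ∧ `p` unramified in the CM field, modulo the Manin datum `p ∤ c(D)` and `p ∤ ∏c_ℓ(E)`,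
`BSD(E,p)` ⟺ STEP L at EVERY Heegner datum of `D` over an imaginary quadratic `K` with the Heegner
hypothesis for `N_E`, `|d_K| > 4`, `d_K` ODD and `L(E^{(d_K)},1) ≠ 0.** "⇒": rigidity. "⇐": such a
field EXISTS — Friedberg–Hoffstein / Waldspurger (PUBLISHED fact `hFH`, at the sign `w(E) = −1`
from modularity `hnf`) with `2` prescribed split, so that `d_K ≡ 1 (mod 8)` is odd —, `D` has a
Heegner datum and a `K`-rational Heegner point over it (Gross 1984 / Darmon 2004 Thm. 3.6), STEP L
there gives the lower half (§1), gen 12's upper half closes. So the `p = 3` inert-bad sub-family of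
X12 has EXACTLY the typed residue of the `p ≥ 5` core: STEP L (`X11b.IndexLowerBoundAt`). Nothing
booked; X12 stays CONSTRUCTION-SHAPED. [cite: JetchevSkinnerWan2017, §7.4.1–7.4.2 (pp. 29–31)]
[cite: MatarNekovar2019, Thm. 0.3 and §0.11] [cite: Darmon2004, Thm. 3.6 and §3.7]
[cite: FriedbergHoffstein1995, main theorem] [cite: Miller2011LMS, §1 and Def. 1.1] -/
theorem bsdp_iff_forall_indexLowerBoundAt_of_classX12_of_bad_odd
    (W : WeierstrassCurve ℚ) [W.IsElliptic] [W.IsGloballyMinimal] (p : ℕ) [Fact p.Prime]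
    [NeZero (W.conductorNorm ℤ)]
    (hX : ClassX12 W p) (hp2 : p ≠ 2) (hbad : ¬ Good W p) (hnr : ¬ CMRamified W p)
    (D : ModularParametrizationData W (W.conductorNorm ℤ)) (hc : ¬ (p : ℤ) ∣ D.c)
    (htam : ¬ p ∣ W.tamagawaProduct) :
    BSDp W p ↔
      ∀ (K : Type) [Field K] [NumberField K]
        (H : HeegnerDatum (W.conductorNorm ℤ) (NumberField.discr K)) (ι : K →+* ℂ)
        (P : (W.baseChange K).toAffine.Point),
        IsImaginaryQuadratic K → SatisfiesHeegnerHypothesis (W.conductorNorm ℤ) K →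
        4 < (NumberField.discr K).natAbs → Odd (NumberField.discr K) →
        WeierstrassCurve.Affine.Point.map ι.toRatAlgHom P = heegnerPointComplex D H →
        (W.quadraticTwist (NumberField.discr K : ℚ)).entireLFunction 1 ≠ 0 →
        (Finite (W.baseChange K).sha → X11b.IndexLowerBoundAt W p K P) := by
  have hp : p.Prime := Fact.out
  have hp3 : 3 ≤ p := by
    have h2 := hp.two_le
    omega
  have hμ_of : ∀ (K : Type) [Field K] [NumberField K], IsImaginaryQuadratic K →
      4 < (NumberField.discr K).natAbs → ¬ p ∣ Units.torsionOrder K := fun K _ _ hK hdisc ↦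
    not_dvd_torsionOrder_of_four_lt_natAbs_discr p hp3 K hK hdisc
  refine ⟨fun hb K _ _ H ι P hK hHN hdisc hodd hP hLt _ ↦ ?_, fun hall ↦ ?_⟩
  · exact indexLowerBoundAt_of_classX12_of_bad_odd_of_bsdp hGZ hKo hGZK hmod hCM8 W p K D H ι P hX
      hp2 hbad hnr hK hodd hHN hP hc (hμ_of K hK hdisc) hLt hb
  · -- the sign of the functional equation is `−1` (modularity, `r_an = 1`)
    have hw : W.rootNumber = -1 := by
      rw [WeierstrassCurve.rootNumber_eq_neg_one_pow_analyticRank_of_exists_isNewformOf hnf W, hX.2.1]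
      norm_num
    -- a Friedberg–Hoffstein field: every `ℓ ∣ N` split, `2` split, `|d_K| > 4`, `L(E^{d_K},1) ≠ 0`
    obtain ⟨K, _, _, hK, hdisc, hHN, hH2, hLt⟩ := hFH W hw 2 Nat.prime_two 4
    have hodd : Odd (NumberField.discr K) := by
      have h2 : ¬ (2 : ℤ) ∣ NumberField.discr K := by
        simpa using Literature.SatisfiesHeegnerHypothesis.not_dvd_discr hK.1 hH2 Nat.prime_two
          (dvd_refl 2)
      exact Int.not_even_iff_odd.mp fun he ↦ h2 (even_iff_two_dvd.mp he)
    -- the Heegner datum and the `K`-rational Heegner point of `D`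
    obtain ⟨β, hβ⟩ := exists_dvd_sq_sub_discr_holds (W.conductorNorm ℤ) K hK hHN
    obtain ⟨H, -⟩ := nonempty_heegnerDatum_holds (W.conductorNorm ℤ) K hK hβ
    obtain ⟨ι⟩ : Nonempty (K →+* ℂ) := inferInstance
    obtain ⟨P, hP⟩ := heegnerPointComplex_mem_range_map_holds (W.conductorNorm ℤ) W K hK hHN D H ι
    exact bsdp_of_classX12_of_bad_odd_of_indexLowerBoundAt hGZ hKo hMN hGZK hmod hnf hFH hCM8 W p K D
      H ι P hX hp2 hbad hnr hK hodd hHN hP hc (hμ_of K hK hdisc) hLt htam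
      (hall K H ι P hK hHN hdisc hodd hP hLt)

/-- **Corollary: `MissingLowerBoundAt W p` ⟺ STEP L at every Heegner datum with odd discriminant**
on X12 ∧ `p ≠ 2` ∧ `p ∣ N` ∧ `p ∤ d_K`, modulo the Manin datum and `p ∤ ∏c_ℓ(E)` — the cell's typed
input on the `p = 3` sub-family may be READ as STEP L, exactly as on the `p ≥ 5` core (gen 10).
[cite: JetchevSkinnerWan2017, §7.4.1 (pp. 30–31)] [cite: Miller2011LMS, §1 and Def. 1.1] -/
theorem missingLowerBoundAt_iff_forall_indexLowerBoundAt_of_classX12_of_bad_odd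
    (W : WeierstrassCurve ℚ) [W.IsElliptic] [W.IsGloballyMinimal] (p : ℕ) [Fact p.Prime]
    [NeZero (W.conductorNorm ℤ)]
    (hX : ClassX12 W p) (hp2 : p ≠ 2) (hbad : ¬ Good W p) (hnr : ¬ CMRamified W p)
    (D : ModularParametrizationData W (W.conductorNorm ℤ)) (hc : ¬ (p : ℤ) ∣ D.c)
    (htam : ¬ p ∣ W.tamagawaProduct) :
    MissingLowerBoundAt W p ↔
      ∀ (K : Type) [Field K] [NumberField K]
        (H : HeegnerDatum (W.conductorNorm ℤ) (NumberField.discr K)) (ι : K →+* ℂ)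
        (P : (W.baseChange K).toAffine.Point),
        IsImaginaryQuadratic K → SatisfiesHeegnerHypothesis (W.conductorNorm ℤ) K →
        4 < (NumberField.discr K).natAbs → Odd (NumberField.discr K) →
        WeierstrassCurve.Affine.Point.map ι.toRatAlgHom P = heegnerPointComplex D H →
        (W.quadraticTwist (NumberField.discr K : ℚ)).entireLFunction 1 ≠ 0 →
        (Finite (W.baseChange K).sha → X11b.IndexLowerBoundAt W p K P) := by
  have hp : p.Prime := Fact.out
  have hp3 : 3 ≤ p := by
    have h2 := hp.two_le
    omega
  refine ⟨fun hlow K _ _ H ι P hK hHN hdisc hodd hP hLt _ ↦ ?_, fun hall ↦ ?_⟩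
  · exact indexLowerBoundAt_of_hasCM_rankOne_of_missingLowerBoundAt_odd hGZK hmod hCM8 W p K D H ι P
      (hGZ _ W K) (hKo _ W K) hX.1 hX.2.1 hp2 hbad hnr hK hodd hHN hP hc
      (not_dvd_torsionOrder_of_four_lt_natAbs_discr p hp3 K hK hdisc) hLt hlow
  · have hb : BSDp W p :=
      (bsdp_iff_forall_indexLowerBoundAt_of_classX12_of_bad_odd hGZ hKo hMN hGZK hmod hnf hFH hCM8 W
        p hX hp2 hbad hnr D hc htam).mpr hall
    haveI : Finite W.sha := (hGZK W (by rw [hX.2.1])).2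
    exact (lower_and_upper_of_missingPPartAt W p (missingPPartAt_of_bsdp W p hb)).1

/-- **The `p = 3` sentence.** On X12 ∧ `3 ∣ N` ∧ `K ≠ ℚ(√−3)` (CM curves with `j ≠ 0`, additive at
`3`, `3` inert or split in `K`), modulo the Manin datum `3 ∤ c(D)` and `3 ∤ ∏c_ℓ(E)`:
`BSD(E,3)` ⟺ STEP L at every Heegner datum of `D` over an imaginary quadratic field with the
Heegner hypothesis, `|d_K| > 4`, `d_K` odd, `L(E^{(d_K)},1) ≠ 0`. The 21 window / 154 census
class-pairs of the `p = 3` inert-bad sub-family thus carry the SAME typed residue as the core.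
[cite: JetchevSkinnerWan2017, §7.4.1–7.4.2 (pp. 29–31)] [cite: MatarNekovar2019, Thm. 0.3 and §0.11]
[cite: Miller2011LMS, §1 and Def. 1.1] -/
theorem bsdp_three_iff_forall_indexLowerBoundAt_of_classX12_of_bad
    (W : WeierstrassCurve ℚ) [W.IsElliptic] [W.IsGloballyMinimal] [NeZero (W.conductorNorm ℤ)]
    (hX : ClassX12 W 3) (hbad : ¬ Good W 3) (hnr : ¬ CMRamified W 3)
    (D : ModularParametrizationData W (W.conductorNorm ℤ)) (hc : ¬ (3 : ℤ) ∣ D.c)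
    (htam : ¬ 3 ∣ W.tamagawaProduct) :
    BSDp W 3 ↔
      ∀ (K : Type) [Field K] [NumberField K]
        (H : HeegnerDatum (W.conductorNorm ℤ) (NumberField.discr K)) (ι : K →+* ℂ)
        (P : (W.baseChange K).toAffine.Point),
        IsImaginaryQuadratic K → SatisfiesHeegnerHypothesis (W.conductorNorm ℤ) K →
        4 < (NumberField.discr K).natAbs → Odd (NumberField.discr K) →
        WeierstrassCurve.Affine.Point.map ι.toRatAlgHom P = heegnerPointComplex D H →
        (W.quadraticTwist (NumberField.discr K : ℚ)).entireLFunction 1 ≠ 0 →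
        (Finite (W.baseChange K).sha → X11b.IndexLowerBoundAt W 3 K P) :=
  bsdp_iff_forall_indexLowerBoundAt_of_classX12_of_bad_odd hGZ hKo hMN hGZK hmod hnf hFH hCM8 W 3 hX
    (by decide) hbad hnr D (by exact_mod_cast hc) htam

end Summit.BirchSwinnertonDyer.Rank1Residual.X12

end
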